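import Summits.QuantumFields.BalabanUV.Beta.SpineRootedS0

/-!
# The ROOTED first-order spine of Bałaban's step jets — part B: the composite stencil `ScAt ρ n`

HONEST FRAMING (cell charter, verbatim): «discharging BetaPertH makes Balaban's UV stability UNCONDITIONAL — a real
constructive-QFT result; it is NOT the continuum limit and NOT the Clay problem.»  DERIVED cell leaf (pub-balaban β sub-cell, lane an2,
work-order (P7′) stage ρ2; see part A `SpineRootedS0` for the why); no statement of Bałaban's papers is typed here, no `[cite:]` tag, no
`Prop` fact; NOT `BetaPertH`; NOT continuum; NOT Clay.

## What is here (decl-by-decl twin of `BalabanCompositeJets` §2–§3, §6–§7 with an1's ROOTED tables)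

`borderIncAt ρ` / `lagrIncAt ρ` (the tree increments with `vhSAt ρ` / `hessFFAt ρ`; the push `pushSum`, the lift `avgLift` and the
multiplier response `lamCoeffOf (KInv N′) N′` are ROOT-FREE and used BY NAME), their `locStencil_…` (in-block roots `ρ = toSite r`,
`r ∈ box (d+1) Lc`; node 7a's constants), `ScAt ρ n` (same recursion, same unit exponents, same three real weights; the root offset is the
SAME `ρ` at every level in the level's own units), `locStencil_ScAt`, the antisymmetry trio and the block-translation trio, and the
bridges `borderIncAt_zero` / `lagrIncAt_zero` / `ScAt_zero : ScAt 0 n = BalabanCompositeJets.Sc n`.  Proofs: those of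
`BalabanCompositeJets` verbatim with an1's rooted lemma names.

Provenance: b2b-balaban β sub-cell, unit beta-an2 gen 11, 2026-08-19 (v1); over part A, `Beta.BalabanCompositeJets` (an2 lineage) and
`Beta.AveragingHessianKernelsRooted` (an1 lineage) BY NAME; no existing file touched.
-/

open Finset
open scoped BigOperators
open Literature.MathematicalPhysics.QuantumFieldTheory
open Literature.MathematicalPhysics.QuantumFieldTheory.Balaban1983to89
open Literature.MathematicalPhysics.QuantumFieldTheory.Balaban1983to89.Beta
open LatticeForm (quo proj_add_zsmul)
open BlochFibreUniqueness (quo_add_zsmul)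
open B12Sec2to5 (l1 l1_nonneg)
open ExpKernelCalculus (Decays BiLoc VertexFamily VertexFamily₂ shiftK Zl Zl_nonneg l1_sub_triangle l1_sub_symm)
open OneStepResolventKernel (Fib LocStencil JetData KInv decays_KInv shiftK_KInv biLoc_mono biLoc_finset_sum)
open AffineAveraging (Form1 Form2 box toSite)
open StepJetData (wilsonA wBound locStencil_wilsonA wilsonA_translate wilsonA_antisymm mfNeg mfNeg_shiftK locStencil_mfNeg
  mfNeg_antisymm locStencil_add locStencil_smul biLoc_smul biLoc_weaken l1_add_le)
open AveragingHessianKernels (vhS hessFF ell)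
open AveragingHessianKernelsRooted (vhSAt locStencil_vhSAt vhSAt_translate vhSAt_symm hessFFAt hessFFAt_antisymm biLoc_hessFFAt
  hessFFAt_translate vhSAt_zero hessFFAt_zero)
open InterLevelTransport (SLam locStencil_SLam SLam_translate cwsum avgLift biLoc_avgLift avgLift_shiftK)
open BalabanStepJets (lamCoeffOf abs_lamCoeffOf_le lamCoeffOf_translate cwsum_antisymm locStencil_mono vertexFamily₂_mono S0)
open BalabanCompositeJets (pushSum biLoc_pushSum biLoc_recenter bshift l1_sub_blockBase_le pushSum_antisymm avgLift_antisymm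
  pushSum_translate)

noncomputable section

namespace Summit.QuantumFields.BalabanUV.Beta.SpineRooted

variable {d : ℕ}

/-! ## §B1 The rooted tree increments -/

section Increments

variable (d)

/-- [folklore] **THE ROOTED BORDER INCREMENT** (twin of `BalabanCompositeJets.borderInc` with an1's `vhSAt ρ`): at the passage from the
`M`-fold to the `(M·Lc)`-fold composite, the one-step field–multiplier kernels of the averaging with comb root `Lc•y + ρ` on the `M`-lattice,
pulled back to the fine legs by `avgLift M`. -/
def borderIncAt (ρ : Fin (d + 1) → ℤ) (Lc M : ℕ) (κ : Fin (d + 1)) (u : Fin (d + 1) → ℤ) : ExpKernelCalculus.MKer (d + 1) (Fib d) :=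
  fun x w a b => ∑ s ∈ Finset.range M, avgLift M (mfNeg (vhSAt ρ d Lc rfl κ (quo M (u - bshift d κ s)))) x w a b

/-- [folklore] **THE ROOTED LAGRANGE INCREMENT** (twin of `BalabanCompositeJets.lagrInc` with an1's `hessFFAt ρ`; the multiplier response
`lamCoeffOf (KInv N′) N′` is root-free). -/
def lagrIncAt (ρ : Fin (d + 1) → ℤ) (Lc M N' : ℕ) [NeZero N'] (κ : Fin (d + 1)) (u : Fin (d + 1) → ℤ) :
    ExpKernelCalculus.MKer (d + 1) (Fib d) :=
  SLam N' (lamCoeffOf (KInv (N := N') (d := d)) N') (fun μ y => avgLift M (hessFFAt ρ Lc μ y)) κ u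

variable {d}

/-- [folklore] Bridges at the corner root. -/
theorem borderIncAt_zero (Lc M : ℕ) : borderIncAt d 0 Lc M = BalabanCompositeJets.borderInc d Lc M := by
  funext κ u x w a b; simp only [borderIncAt, BalabanCompositeJets.borderInc, vhSAt_zero]

/-- [folklore] At the root `ρ = 0` the rooted Lagrange-increment border `lagrIncAt d 0` IS the unrooted one of `BalabanCompositeJets`. -/
theorem lagrIncAt_zero (Lc M N' : ℕ) [NeZero N'] : lagrIncAt d 0 Lc M N' = BalabanCompositeJets.lagrInc d Lc M N' := by
  funext κ u; simp only [lagrIncAt, BalabanCompositeJets.lagrInc, hessFFAt_zero]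

/-- [folklore] **THE ROOTED BORDER INCREMENT IS A LOCAL STENCIL FAMILY** (in-block roots), the constant of `locStencil_borderInc`. -/
theorem locStencil_borderIncAt {Lc M : ℕ} [NeZero M] (hLc : 1 ≤ Lc) {r : Fin (d + 1) → ℕ} (hr : r ∈ box (d + 1) Lc) {δ : ℝ}
    (hδ : 0 ≤ δ) :
    LocStencil (borderIncAt d (toSite r) Lc M)
      (M * (3 * (ell (d + 1) Lc : ℝ) ^ 2 * Real.exp (4 * ((d : ℝ) + 1) * Lc * (M * δ)) * Real.exp (4 * (d + 1) * (M * δ)) *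
        Real.exp (2 * δ * ((d + 2) * M)))) δ := by
  have hM0 : (M : ℝ) ≠ 0 := by exact_mod_cast NeZero.ne M
  have hMδ : 0 ≤ (M : ℝ) * δ := mul_nonneg (Nat.cast_nonneg M) hδ
  intro κ u
  set C0 := 3 * (ell (d + 1) Lc : ℝ) ^ 2 * Real.exp (4 * ((d : ℝ) + 1) * Lc * (M * δ)) * Real.exp (4 * (d + 1) * (M * δ)) with hC0
  have hC0nn : 0 ≤ C0 := by positivity
  have hterm : ∀ s ∈ Finset.range M,
      BiLoc (avgLift M (mfNeg (vhSAt (toSite r) d Lc rfl κ (quo M (u - bshift d κ s))))) u u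
        (C0 * Real.exp (2 * δ * ((d + 2) * M))) δ := by
    intro s hs
    set z := quo M (u - bshift d κ s) with hz
    have hG : BiLoc (mfNeg (vhSAt (toSite r) d Lc rfl κ z)) z z
        (3 * (ell (d + 1) Lc : ℝ) ^ 2 * Real.exp (4 * ((d : ℝ) + 1) * Lc * (M * δ))) (M * δ) :=
      locStencil_mfNeg (locStencil_vhSAt hLc hr hMδ) κ z
    have hA := biLoc_avgLift M hG hMδ
    rw [mul_div_cancel_left₀ δ hM0] at hA
    have hR := biLoc_recenter hA hδ u
    refine biLoc_weaken hR ?_ le_rfl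
    refine mul_le_mul_of_nonneg_left (Real.exp_le_exp.2 ?_) hC0nn
    exact mul_le_mul_of_nonneg_left (l1_sub_blockBase_le M u κ (Finset.mem_range.1 hs)) (by positivity)
  have hsum := biLoc_finset_sum (Finset.range M) hterm
  simp only [Finset.sum_const, Finset.card_range, nsmul_eq_mul] at hsum
  exact hsum

/-- [folklore] **THE ROOTED LAGRANGE INCREMENT IS A LOCAL STENCIL FAMILY** (in-block roots; rate existential, as `locStencil_lagrInc`). -/
theorem locStencil_lagrIncAt {Lc M N' : ℕ} [NeZero M] [NeZero N'] (hLc : 1 ≤ Lc) {r : Fin (d + 1) → ℕ} (hr : r ∈ box (d + 1) Lc)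
    (hN : N' = M * Lc) : ∃ C δ : ℝ, 0 < δ ∧ LocStencil (lagrIncAt d (toSite r) Lc M N') C δ := by
  obtain ⟨δ₀, C, hδ₀, hC, hdec⟩ := decays_KInv (N := N') (d := d)
  have hM0 : (M : ℝ) ≠ 0 := by exact_mod_cast NeZero.ne M
  have hMδ : 0 ≤ (M : ℝ) * δ₀ := mul_nonneg (Nat.cast_nonneg M) hδ₀.le
  have hc := abs_lamCoeffOf_le (N := N') hdec hC hδ₀.le
  have hQ : VertexFamily (fun μ y => avgLift M (hessFFAt (toSite r) Lc μ y)) N'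
      (2 * (ell (d + 1) Lc : ℝ) ^ 2 * Real.exp (4 * ((d : ℝ) + 1) * Lc * (M * δ₀)) * Real.exp (4 * (d + 1) * (M * δ₀))) δ₀ := by
    intro μ y
    have hA := biLoc_avgLift M (biLoc_hessFFAt hLc μ y hr hMδ) hMδ
    rw [mul_div_cancel_left₀ δ₀ hM0, ← mul_smul, ← Nat.cast_mul, ← hN] at hA
    exact hA
  have h3 := locStencil_SLam (N := N') hc hQ hδ₀ (mul_nonneg (mul_nonneg (by positivity) hC) (Real.exp_pos _).le)
  exact ⟨_, δ₀ / 2, by positivity, h3⟩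

end Increments

/-! ## §B2 The rooted composite stencil family `ScAt ρ n` (composite level `n + 1`) -/

section Composite

variable (d) (Lc : ℕ) [NeZero Lc]

/-- [folklore] **THE ROOTED COMPOSITE FIRST-ORDER STENCIL FAMILY** (twin of `BalabanCompositeJets.Sc`, same unit exponents, same three
real weights; comb root offset `ρ` at EVERY level in the level's own units — for the centred comb `ρ = toSite (ctrOff (d+1) Lc)` at each
one-step averaging): `ScAt ρ 0 := S0At ρ`,
`ScAt ρ (n+1) κ u := Lc^{d+1} • pushSum (Lc^{n+1}) Lc (ScAt ρ n κ u) + (cVH·(Lc^{n+1})^{d+2}) • borderIncAt ρ Lc (Lc^{n+1}) κ u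
  + (cΛ·(Lc^{n+1})^{2d+4}) • lagrIncAt ρ Lc (Lc^{n+1}) (Lc^{n+2}) κ u`. -/
def ScAt (ρ : Fin (d + 1) → ℤ) (cE cVH cΛ : ℝ) : ℕ → Fin (d + 1) → (Fin (d + 1) → ℤ) → ExpKernelCalculus.MKer (d + 1) (Fib d)
  | 0 => S0At d Lc ρ cE cVH cΛ
  | n + 1 => fun κ u =>
      ((Lc : ℝ) ^ (d + 1)) • pushSum (Lc ^ (n + 1)) Lc (ScAt ρ cE cVH cΛ n κ u) +
        (cVH * ((Lc : ℝ) ^ (n + 1)) ^ (d + 2)) • borderIncAt d ρ Lc (Lc ^ (n + 1)) κ u +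
        (cΛ * ((Lc : ℝ) ^ (n + 1)) ^ (2 * d + 4)) • lagrIncAt d ρ Lc (Lc ^ (n + 1)) (Lc ^ (n + 2)) κ u

variable {d Lc}

/-- [folklore] Level `0` of the rooted composite first-order table `ScAt` is the rooted level-`0` table `S0At`. -/
@[simp] theorem ScAt_zero_level (ρ : Fin (d + 1) → ℤ) (cE cVH cΛ : ℝ) : ScAt d Lc ρ cE cVH cΛ 0 = S0At d Lc ρ cE cVH cΛ := rfl

/-- [folklore] The recursion step (unfolding lemma). -/
theorem ScAt_succ (ρ : Fin (d + 1) → ℤ) (cE cVH cΛ : ℝ) (n : ℕ) : ScAt d Lc ρ cE cVH cΛ (n + 1) = fun κ u =>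
    ((Lc : ℝ) ^ (d + 1)) • pushSum (Lc ^ (n + 1)) Lc (ScAt d Lc ρ cE cVH cΛ n κ u) +
      (cVH * ((Lc : ℝ) ^ (n + 1)) ^ (d + 2)) • borderIncAt d ρ Lc (Lc ^ (n + 1)) κ u +
      (cΛ * ((Lc : ℝ) ^ (n + 1)) ^ (2 * d + 4)) • lagrIncAt d ρ Lc (Lc ^ (n + 1)) (Lc ^ (n + 2)) κ u := rfl

/-- [folklore] **BRIDGE:** at the corner root, `ScAt 0 n = BalabanCompositeJets.Sc n` for every `n`. -/
theorem ScAt_zero (cE cVH cΛ : ℝ) : ∀ n : ℕ, ScAt d Lc 0 cE cVH cΛ n = BalabanCompositeJets.Sc d Lc cE cVH cΛ n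
  | 0 => by rw [ScAt_zero_level, BalabanCompositeJets.Sc_zero, S0At_zero]
  | n + 1 => by
      rw [ScAt_succ, BalabanCompositeJets.Sc_succ, ScAt_zero cE cVH cΛ n, borderIncAt_zero, lagrIncAt_zero]

/-- [folklore] **EVERY ROOTED COMPOSITE STENCIL FAMILY IS A LOCAL STENCIL FAMILY** (in-block roots; rate existential per level). -/
theorem locStencil_ScAt (hLc : 1 ≤ Lc) {r : Fin (d + 1) → ℕ} (hr : r ∈ box (d + 1) Lc) (cE cVH cΛ : ℝ) :
    ∀ n : ℕ, ∃ Cs δ : ℝ, 0 < δ ∧ LocStencil (ScAt d Lc (toSite r) cE cVH cΛ n) Cs δ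
  | 0 => locStencil_S0At hLc hr cE cVH cΛ
  | n + 1 => by
      obtain ⟨Cs, δ, hδ, hloc⟩ := locStencil_ScAt hLc hr cE cVH cΛ n
      obtain ⟨CL, δL, hδL, hlocL⟩ :=
        locStencil_lagrIncAt (d := d) (Lc := Lc) (M := Lc ^ (n + 1)) (N' := Lc ^ (n + 2)) hLc hr (pow_succ Lc (n + 1))
      have hCs : 0 ≤ Cs := (hloc 0 0).nonneg (Sum.inl 0)
      have hCL : 0 ≤ CL := (hlocL 0 0).nonneg (Sum.inl 0)
      have h1 : LocStencil (fun κ u => pushSum (Lc ^ (n + 1)) Lc (ScAt d Lc (toSite r) cE cVH cΛ n κ u))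
          (Cs * ((Lc : ℝ) ^ (d + 2)) ^ 2 * Real.exp (4 * (d + 1) * (Lc ^ (n + 1) : ℕ) * Lc * δ)) δ :=
        fun κ u => biLoc_pushSum (M := Lc ^ (n + 1)) hLc (hloc κ u) hδ.le
      have h2 := locStencil_borderIncAt (d := d) (Lc := Lc) (M := Lc ^ (n + 1)) hLc hr hδ.le
      have h1' := locStencil_mono h1 ((h1 0 0).nonneg (Sum.inl 0)) (min_le_left δ δL)
      have h2' := locStencil_mono h2 ((h2 0 0).nonneg (Sum.inl 0)) (min_le_left δ δL)
      have h3' := locStencil_mono hlocL hCL (min_le_right δ δL)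
      have hfin := locStencil_add (locStencil_add (locStencil_smul ((Lc : ℝ) ^ (d + 1)) h1')
        (locStencil_smul (cVH * ((Lc : ℝ) ^ (n + 1)) ^ (d + 2)) h2'))
        (locStencil_smul (cΛ * ((Lc : ℝ) ^ (n + 1)) ^ (2 * d + 4)) h3')
      exact ⟨_, min δ δL, lt_min hδ hδL, fun κ u => by rw [ScAt_succ]; exact hfin κ u⟩

end Composite

/-! ## §B3 Antisymmetry (the stripping convention survives, all roots) -/

section Antisymm

variable {Lc : ℕ} [NeZero Lc]

omit [NeZero Lc] in
/-- [folklore] an1's rooted field–multiplier kernel through the block-sign adapter is antisymmetric. -/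
theorem mfNeg_vhSAt_antisymm (ρ : Fin (d + 1) → ℤ) (Lc : ℕ) (κ : Fin (d + 1)) (u x z : Fin (d + 1) → ℤ) (a b : Fib d) :
    mfNeg (vhSAt ρ d Lc rfl κ u) z x b a = -mfNeg (vhSAt ρ d Lc rfl κ u) x z a b :=
  mfNeg_antisymm (K := vhSAt ρ d Lc rfl κ u) (fun x z a b => vhSAt_symm ρ Lc κ u x z a b)
    (fun _ _ _ _ => rfl) (fun _ _ _ _ => rfl) x z a b

omit [NeZero Lc] in
/-- [folklore] The rooted border increment is antisymmetric. -/
theorem borderIncAt_antisymm (ρ : Fin (d + 1) → ℤ) (Lc M : ℕ) (κ : Fin (d + 1)) (u x z : Fin (d + 1) → ℤ) (a b : Fib d) :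
    borderIncAt d ρ Lc M κ u z x b a = -borderIncAt d ρ Lc M κ u x z a b := by
  simp only [borderIncAt]
  rw [← Finset.sum_neg_distrib]
  exact Finset.sum_congr rfl fun s _ => avgLift_antisymm M (fun x z a b => mfNeg_vhSAt_antisymm ρ Lc κ _ x z a b) x z a b

omit [NeZero Lc] in
/-- [folklore] The rooted Lagrange increment is antisymmetric. -/
theorem lagrIncAt_antisymm (ρ : Fin (d + 1) → ℤ) (Lc M N' : ℕ) [NeZero N'] (κ : Fin (d + 1)) (u x z : Fin (d + 1) → ℤ)
    (a b : Fib d) : lagrIncAt d ρ Lc M N' κ u z x b a = -lagrIncAt d ρ Lc M N' κ u x z a b := by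
  simp only [lagrIncAt, SLam, neg_neg]
  rw [← Finset.sum_neg_distrib]
  exact Finset.sum_congr rfl fun μ _ => by
    rw [cwsum_antisymm _ (fun y x z a b =>
      avgLift_antisymm M (fun x z a b => hessFFAt_antisymm ρ Lc μ y x z a b) x z a b) x z a b, neg_neg]

/-- [folklore] **EVERY ROOTED COMPOSITE STENCIL FAMILY IS ANTISYMMETRIC ON THE PACKED FIBRE** (all roots). -/
theorem ScAt_antisymm (ρ : Fin (d + 1) → ℤ) (cE cVH cΛ : ℝ) :
    ∀ (n : ℕ) (κ : Fin (d + 1)) (u x z : Fin (d + 1) → ℤ) (a b : Fib d),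
      ScAt d Lc ρ cE cVH cΛ n κ u z x b a = -ScAt d Lc ρ cE cVH cΛ n κ u x z a b
  | 0, κ, u, x, z, a, b => S0At_antisymm ρ cE cVH cΛ κ u x z a b
  | n + 1, κ, u, x, z, a, b => by
      have h1 := pushSum_antisymm (Lc ^ (n + 1)) Lc (fun x z a b => ScAt_antisymm ρ cE cVH cΛ n κ u x z a b) x z a b
      have h2 := borderIncAt_antisymm (d := d) ρ Lc (Lc ^ (n + 1)) κ u x z a b
      have h3 := lagrIncAt_antisymm (d := d) ρ Lc (Lc ^ (n + 1)) (Lc ^ (n + 2)) κ u x z a b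
      simp only [ScAt_succ, Pi.add_apply, Pi.smul_apply, smul_eq_mul]
      rw [h1, h2, h3]
      ring

end Antisymm

/-! ## §B4 Block-translation covariance (coarse lattice of the level, all roots) -/

section Translate

variable {Lc : ℕ} [NeZero Lc]

omit [NeZero Lc] in
/-- [folklore] **BLOCK-TRANSLATION COVARIANCE OF THE ROOTED BORDER INCREMENT** under `(M·Lc)•ℤ^{d+1}` (an1's `vhSAt_translate`). -/
theorem borderIncAt_translate (ρ : Fin (d + 1) → ℤ) (M : ℕ) [NeZero M] (hLc : 1 ≤ Lc) (κ : Fin (d + 1)) (u t : Fin (d + 1) → ℤ) :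
    borderIncAt d ρ Lc M κ (u + ((M * Lc : ℕ) : ℤ) • t) = shiftK (-(((M * Lc : ℕ) : ℤ) • t)) (borderIncAt d ρ Lc M κ u) := by
  have e : (M : ℤ) • -((Lc : ℤ) • t) = -(((M * Lc : ℕ) : ℤ) • t) := by rw [smul_neg, smul_smul, Nat.cast_mul]
  funext x w a b
  simp only [borderIncAt, shiftK]
  refine Finset.sum_congr rfl fun s _ => ?_
  have hq : quo M (u + ((M * Lc : ℕ) : ℤ) • t - bshift d κ s) = quo M (u - bshift d κ s) + (Lc : ℤ) • t := by
    rw [show u + ((M * Lc : ℕ) : ℤ) • t - bshift d κ s = (u - bshift d κ s) + (M : ℤ) • ((Lc : ℤ) • t) by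
      rw [smul_smul, ← Nat.cast_mul]; abel, quo_add_zsmul]
  rw [hq, vhSAt_translate ρ hLc, mfNeg_shiftK, avgLift_shiftK, e]
  rfl

omit [NeZero Lc] in
/-- [folklore] **BLOCK-TRANSLATION COVARIANCE OF THE ROOTED LAGRANGE INCREMENT** under `N′•ℤ^{d+1}`, `N′ = M·Lc`. -/
theorem lagrIncAt_translate (ρ : Fin (d + 1) → ℤ) (M N' : ℕ) [NeZero M] [NeZero N'] (hN : N' = M * Lc) (κ : Fin (d + 1))
    (u t : Fin (d + 1) → ℤ) :
    lagrIncAt d ρ Lc M N' κ (u + (N' : ℤ) • t) = shiftK (-((N' : ℤ) • t)) (lagrIncAt d ρ Lc M N' κ u) := by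
  unfold lagrIncAt
  refine SLam_translate (N := N') ?_ ?_ κ u t
  · intro μ y κ'' u' t'
    exact lamCoeffOf_translate (fun s => shiftK_KInv (N := N') (d := d) s) μ y κ'' u' t'
  · intro μ y t'
    show avgLift M (hessFFAt ρ Lc μ (y + t')) = shiftK (-((N' : ℤ) • t')) (avgLift M (hessFFAt ρ Lc μ y))
    rw [hessFFAt_translate, avgLift_shiftK]
    congr 1
    rw [smul_neg, smul_smul, hN, Nat.cast_mul]

/-- [folklore] **BLOCK-TRANSLATION COVARIANCE OF THE ROOTED COMPOSITE STENCIL FAMILIES** at blocking `Lc^{n+1}` (all roots). -/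
theorem ScAt_translate (ρ : Fin (d + 1) → ℤ) (hLc : 1 ≤ Lc) (cE cVH cΛ : ℝ) : ∀ (n : ℕ) (κ : Fin (d + 1)) (u t : Fin (d + 1) → ℤ),
    ScAt d Lc ρ cE cVH cΛ n κ (u + (((Lc ^ (n + 1) : ℕ) : ℤ)) • t)
      = shiftK (-((((Lc ^ (n + 1) : ℕ) : ℤ)) • t)) (ScAt d Lc ρ cE cVH cΛ n κ u)
  | 0, κ, u, t => by
    rw [ScAt_zero_level, show ((Lc ^ (0 + 1) : ℕ) : ℤ) = (Lc : ℤ) by rw [zero_add, pow_one]]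
    exact S0At_translate ρ hLc cE cVH cΛ κ u t
  | n + 1, κ, u, t => by
    have eN : Lc ^ (n + 1 + 1) = Lc ^ (n + 1) * Lc := pow_succ Lc (n + 1)
    have ea : ((Lc ^ (n + 1) : ℕ) : ℤ) • ((Lc : ℤ) • t) = ((Lc ^ (n + 1 + 1) : ℕ) : ℤ) • t := by
      rw [smul_smul, eN, Nat.cast_mul]
    have IH := ScAt_translate ρ hLc cE cVH cΛ n κ u ((Lc : ℤ) • t)
    rw [ea] at IH
    have h1 : pushSum (Lc ^ (n + 1)) Lc (ScAt d Lc ρ cE cVH cΛ n κ (u + ((Lc ^ (n + 1 + 1) : ℕ) : ℤ) • t))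
        = shiftK (-(((Lc ^ (n + 1 + 1) : ℕ) : ℤ) • t)) (pushSum (Lc ^ (n + 1)) Lc (ScAt d Lc ρ cE cVH cΛ n κ u)) := by
      have hp := pushSum_translate (Lc ^ (n + 1)) Lc (ScAt d Lc ρ cE cVH cΛ n κ u) t
      rw [← eN] at hp
      rw [IH, hp]
    have h2 : borderIncAt d ρ Lc (Lc ^ (n + 1)) κ (u + ((Lc ^ (n + 1 + 1) : ℕ) : ℤ) • t)
        = shiftK (-(((Lc ^ (n + 1 + 1) : ℕ) : ℤ) • t)) (borderIncAt d ρ Lc (Lc ^ (n + 1)) κ u) := by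
      have hb := borderIncAt_translate (Lc := Lc) ρ (Lc ^ (n + 1)) hLc κ u t
      rw [← eN] at hb
      exact hb
    have h3 := lagrIncAt_translate (Lc := Lc) (d := d) ρ (Lc ^ (n + 1)) (Lc ^ (n + 1 + 1)) eN κ u t
    funext x w a b
    rw [ScAt_succ]
    simp only [Pi.add_apply, Pi.smul_apply, smul_eq_mul]
    rw [h1, h2, h3]
    rfl

end Translate

end Summit.QuantumFields.BalabanUV.Beta.SpineRooted

end
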